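import Summits.Ventures.HSemireg.WedgeHankelRecurrenceGaussChebyshevTUComparison

/-!
# Venture HSemireg — **SUP NORMS AND EQUIOSCILLATION: `max_{[−1,1]} |T_n| = 1`, `max_{[−1,1]} |U_n| = n + 1`, `max_{[−2,2]} |C_n| = 2`, `max_{[−2,2]} |S_n| = n + 1` as `IsGreatest ∕ sSup`
# statements, and the alternation values `C_n(2cos(kπ∕n)) = 2(−1)^k`, `S_{n−1}(2cos(kπ∕n)) = 0` (`0 < k < n`)** (the extremal points of `C_n` on `[−2, 2]` are the roots of `S_{n−1}` and the endpoints)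

HONEST FRAMING. Part of the Lean index of the computation cell `pub-hsemireg` (seat p10 gen 49, Sunday typer «UNIFORM-IN-n»).  Real polynomial inequalities only (Mathlib `Polynomial.Chebyshev.T ∕ U ∕
C ∕ S` over `ℝ`, `IsGreatest`, `sSup`); no variety, no cohomology theory, no sheaf, no Ext group and no semiregularity map is constructed here; nothing here says that HC / HC_CM / HC_AV holds; no
Literature fact (unproved `Prop`) is declared or used.  Custodian versions as in `WedgeHankelSiegelIdeal` (1/3).
SOURCES (cited).  T. J. Rivlin, *The Chebyshev Polynomials* (Wiley 1974), §1.2, §2.7 (sup norms, equioscillation `T_n(cos(kπ∕n)) = (−1)^k`); NIST DLMF §18.14(i).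
PROOF TYPED HERE.  Upper bounds: Mathlib `abs_eval_T_real_le_one`, the LANDED `Literature…FitznerVanDerHofstad2017.abs_eval_U_le`, and their `x∕2` transports (N521 `chebyshevC_eval_eq_two_mul_T_eval_half`,
`chebyshevS_eval_eq_U_eval_half`); attained at `x = 1` resp. `x = 2` (Mathlib `T_eval_one`, `U_eval_one`, `C_eval_two`, `S_eval_two`); `sSup` by `IsGreatest.csSup_eq`.  Alternation: Mathlib
`eval_T_real_cos_int_mul_pi_div` (`T_n(cos(kπ∕n)) = (−1)^k`) at `x∕2`, and N500 `chebyshevS_eval_eq_zero_iff_real`.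
DEDUP DISCLOSURE (`rg -n 'IsGreatest|sSup' Summits/Ventures/HSemireg -g 'WedgeHankelRecurrenceGaussChebyshev*'` — none; 2026-09-04): the bounds themselves are Mathlib ∕ Literature ∕ N521–N523 (used, not
restated as inequalities); the `IsGreatest ∕ sSup` packaging and the `C ∕ S` alternation values are new; Mathlib has the `T` alternation `eval_T_real_cos_int_mul_pi_div` (USED); 0 hits for the
10 names below.

WHAT IS IN THE TREE.  N500 `chebyshevS_eval_eq_zero_iff_real`; N521 `chebyshevC_eval_eq_two_mul_T_eval_half`, `chebyshevS_eval_eq_U_eval_half`; `Literature…abs_eval_U_le`; Mathlib `abs_eval_T_real_le_one`,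
`eval_T_real_cos_int_mul_pi_div`, `T_eval_one`, `U_eval_one`, `C_eval_two`, `S_eval_two`, `IsGreatest.csSup_eq`, `Int.cast_negOnePow_natCast`.
THIS FILE (namespace `Summit.Ventures.HSemireg.Wedge.HankelOuter` continued; CHAINED on N533; 0 definitions):
* §1299 **`isGreatest_abs_eval_chebyshevT_real`** (`1` on `[−1,1]`), **`isGreatest_abs_eval_chebyshevU_real`** (`n+1` on `[−1,1]`), **`isGreatest_abs_eval_chebyshevC_real`** (`2` on `[−2,2]`),
  **`isGreatest_abs_eval_chebyshevS_real`** (`n+1` on `[−2,2]`), `sSup_abs_eval_chebyshevT_real`, `sSup_abs_eval_chebyshevU_real`, `sSup_abs_eval_chebyshevC_real`, `sSup_abs_eval_chebyshevS_real`;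
  **`chebyshevC_eval_two_mul_cos_mul_pi_div`** (`C_n(2cos(kπ∕n)) = 2(−1)^k`, `n ≠ 0`), **`chebyshevS_pred_eval_two_mul_cos_mul_pi_div`** (`S_{n−1}(2cos(kπ∕n)) = 0`, `0 < k < n`).
CAVEATS.  `T ∕ U ∕ S` statements for `n ∈ ℕ`, `C` for `n ∈ ℤ` (the `C` alternation for `n ∈ ℕ`, `n ≠ 0`).  Nothing Ext-side.  New names only.
-/

open Module Polynomial
open scoped Matrix Polynomial

namespace Summit.Ventures.HSemireg.Wedge.HankelOuter

/-! ## §1299. Sup norms as `IsGreatest` ∕ `sSup`, and the alternation values -/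

/-- **`max_{[−1,1]} |T_n| = 1`**, attained at `x = 1`. [Rivlin 1974, §1.2; this file, §1299] -/
theorem isGreatest_abs_eval_chebyshevT_real (n : ℤ) : IsGreatest ((fun x : ℝ => |(Polynomial.Chebyshev.T ℝ n).eval x|) '' Set.Icc (-1) 1) 1 := by
  refine ⟨⟨1, ⟨by norm_num, le_rfl⟩, by simp [Polynomial.Chebyshev.T_eval_one]⟩, ?_⟩
  rintro y ⟨x, hx, rfl⟩
  exact Polynomial.Chebyshev.abs_eval_T_real_le_one n (abs_le.mpr hx)

/-- **`max_{[−1,1]} |U_n| = n + 1`**, attained at `x = 1` (upper bound = the LANDED `Literature…abs_eval_U_le`). [Rivlin 1974, §1.2; DLMF 18.14.7; this file, §1299] -/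
theorem isGreatest_abs_eval_chebyshevU_real (n : ℕ) : IsGreatest ((fun x : ℝ => |(Polynomial.Chebyshev.U ℝ (n : ℤ)).eval x|) '' Set.Icc (-1) 1) ((n : ℝ) + 1) := by
  refine ⟨⟨1, ⟨by norm_num, le_rfl⟩, ?_⟩, ?_⟩
  · simp only [Polynomial.Chebyshev.U_eval_one]
    push_cast
    exact abs_of_nonneg (by positivity)
  · rintro y ⟨x, hx, rfl⟩
    exact Literature.Probability.FitznerVanDerHofstad2017.abs_eval_U_le n (abs_le.mpr hx)

/-- **`max_{[−2,2]} |C_n| = 2`**, attained at `x = 2` (`C_n(x) = 2T_n(x∕2)`). [Rivlin 1974, §1.2; this file, §1299] -/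
theorem isGreatest_abs_eval_chebyshevC_real (n : ℤ) : IsGreatest ((fun x : ℝ => |(Polynomial.Chebyshev.C ℝ n).eval x|) '' Set.Icc (-2) 2) 2 := by
  refine ⟨⟨2, ⟨by norm_num, le_rfl⟩, by simp [Polynomial.Chebyshev.C_eval_two]⟩, ?_⟩
  rintro y ⟨x, hx, rfl⟩
  simp only [chebyshevC_eval_eq_two_mul_T_eval_half, abs_mul, abs_two]
  have h := Polynomial.Chebyshev.abs_eval_T_real_le_one n (show |x / 2| ≤ 1 by rw [abs_div, abs_two]; exact (div_le_one two_pos).mpr (abs_le.mpr hx))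
  linarith

/-- **`max_{[−2,2]} |S_n| = n + 1`**, attained at `x = 2` (`S_n(x) = U_n(x∕2)`). [Rivlin 1974, §1.2; this file, §1299] -/
theorem isGreatest_abs_eval_chebyshevS_real (n : ℕ) : IsGreatest ((fun x : ℝ => |(Polynomial.Chebyshev.S ℝ (n : ℤ)).eval x|) '' Set.Icc (-2) 2) ((n : ℝ) + 1) := by
  refine ⟨⟨2, ⟨by norm_num, le_rfl⟩, ?_⟩, ?_⟩
  · simp only [Polynomial.Chebyshev.S_eval_two]
    push_cast
    exact abs_of_nonneg (by positivity)
  · rintro y ⟨x, hx, rfl⟩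
    simp only [chebyshevS_eval_eq_U_eval_half]
    exact Literature.Probability.FitznerVanDerHofstad2017.abs_eval_U_le n (show |x / 2| ≤ 1 by rw [abs_div, abs_two]; exact (div_le_one two_pos).mpr (abs_le.mpr hx))

/-- `sup_{[−1,1]} |T_n| = 1`. [this file, §1299] -/
theorem sSup_abs_eval_chebyshevT_real (n : ℤ) : sSup ((fun x : ℝ => |(Polynomial.Chebyshev.T ℝ n).eval x|) '' Set.Icc (-1) 1) = 1 :=
  (isGreatest_abs_eval_chebyshevT_real n).csSup_eq

/-- `sup_{[−1,1]} |U_n| = n + 1`. [this file, §1299] -/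
theorem sSup_abs_eval_chebyshevU_real (n : ℕ) : sSup ((fun x : ℝ => |(Polynomial.Chebyshev.U ℝ (n : ℤ)).eval x|) '' Set.Icc (-1) 1) = (n : ℝ) + 1 :=
  (isGreatest_abs_eval_chebyshevU_real n).csSup_eq

/-- `sup_{[−2,2]} |C_n| = 2`. [this file, §1299] -/
theorem sSup_abs_eval_chebyshevC_real (n : ℤ) : sSup ((fun x : ℝ => |(Polynomial.Chebyshev.C ℝ n).eval x|) '' Set.Icc (-2) 2) = 2 :=
  (isGreatest_abs_eval_chebyshevC_real n).csSup_eq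

/-- `sup_{[−2,2]} |S_n| = n + 1`. [this file, §1299] -/
theorem sSup_abs_eval_chebyshevS_real (n : ℕ) : sSup ((fun x : ℝ => |(Polynomial.Chebyshev.S ℝ (n : ℤ)).eval x|) '' Set.Icc (-2) 2) = (n : ℝ) + 1 :=
  (isGreatest_abs_eval_chebyshevS_real n).csSup_eq

/-! ### Alternation values -/

/-- **`C_n(2cos(kπ∕n)) = 2(−1)^k`** for `n ≠ 0`, `k ∈ ℕ` (Mathlib `T_n(cos(kπ∕n)) = (−1)^k` at `x∕2`). [Rivlin 1974, §1.2; this file, §1299] -/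
theorem chebyshevC_eval_two_mul_cos_mul_pi_div {n : ℕ} (hn : n ≠ 0) (k : ℕ) :
    (Polynomial.Chebyshev.C ℝ (n : ℤ)).eval (2 * Real.cos (k * Real.pi / n)) = 2 * (-1) ^ k := by
  rw [chebyshevC_eval_eq_two_mul_T_eval_half, show 2 * Real.cos (k * Real.pi / n) / 2 = Real.cos (k * Real.pi / n) by ring,
    Polynomial.Chebyshev.eval_T_real_cos_int_mul_pi_div hn, Int.cast_negOnePow_natCast]

/-- **`S_{n−1}(2cos(kπ∕n)) = 0`** for `0 < k < n` (the interior extremal points of `C_n` on `[−2, 2]` are the roots of `S_{n−1}`; N500). [Rivlin 1974, §1.2; this file, §1299] -/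
theorem chebyshevS_pred_eval_two_mul_cos_mul_pi_div {n k : ℕ} (hk : 0 < k) (hkn : k < n) :
    (Polynomial.Chebyshev.S ℝ ((n - 1 : ℕ) : ℤ)).eval (2 * Real.cos (k * Real.pi / n)) = 0 := by
  rw [chebyshevS_eval_eq_zero_iff_real]
  refine ⟨k - 1, by omega, ?_⟩
  congr 2
  rw [Nat.cast_sub (by omega : 1 ≤ k), Nat.cast_sub (by omega : 1 ≤ n)]
  push_cast
  ring

end Summit.Ventures.HSemireg.Wedge.HankelOuter
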